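import Literature.NumberTheory.EllipticCurves.FineSelmerRankEqualityNonsplitCartanFiveInertia
import Literature.NumberTheory.NumberFields.EquivariantIwasawaLemmaInertia
import HarnessLib

/-!
# Statement (A) of Coates–Sujatha at `(E, 5)` for a `C_ns⁺(5)` image from the LAYER-0 ISOTYPIC INPUT ALONE
# (`Hom_{Γ_ℚ}(Cl(𝓞_{ℚ(E[5])}), E[5]) = 0`): the inertia input (c3*) of door L6 is automatic

Topic `NumberTheory/EllipticCurves` (grouping sub-namespace `CoatesSujatha2005.RankEqualityRoad`).  THEOREM-ONLY (no definition, no named fact, no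
`sorry`); prover seat `bsd-potss-k8t-c4` g26 (cell `bsd-potss`, `--supports stmt-BirchSwinnertonDyer-19982`; closes nothing; neither BSD nor
Conjecture A is booked for any curve).

Door L6 in inertia form (k8t-c4 g25, `EquivariantIwasawaLemma.equivariantHom_classGroup_eq_zero_layer_compositum_tower_of_inertia`): for `V` a
`p`-torsion `Γ_k`-module trivialised by `Γ_{L₀}`, (c2*)₀ `Hom_{Γ_k}(Cl(𝓞_{L₀}), V) = 0` and (c3*-I) «no non-zero vector fixed by an inertia group
`I(𝔮)`, `𝔮 ∣ p`» give `Hom_{Γ_k}(Cl(𝓞_{L₀K_n}), V) = 0` at every layer, hence statement (A) by door L5.  For `V = E[5]`, `L₀ = ℚ(E[5])` with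
mod-`5` image `C_ns⁺(5)`, (c3*-I) is AUTOMATIC: `σ̄_x¹² = −1 ∈ I(𝔮)` for every `𝔮 ∋ 5` (k8t-c4 g26,
`pow_twelve_mem_inertia_of_nonsplitCartanNormalizer` — `det ρ̄(I(𝔮|5)) = 𝔽₅ˣ` by the Weil pairing and the total ramification of `5` in `ℚ(ζ₅)`),
and `−1` fixes no non-zero vector.  Hence:

* `not_five_dvd_card_gal_of_nonsplitCartanNormalizer` — (c1) `5 ∤ #Gal(ℚ(E[5])/ℚ)` for an image in `C_ns⁺(ε)` (orders divide `24`);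
* `conjA_five_of_nonsplitCartanBasis_of_homTrivial_layerZero` — statement (A) at `(E, 5)` for every cyclotomic `ℤ_5`-extension from the basis
  data and the SINGLE layer-0 input (c2*)₀.  This is WEAKER than the rank-equality input of `conjA_five_of_nonsplitCartanBasis_of_rankEq'`
  (rank equality forces EVERY odd constituent of `Cl(ℚ(E[5]))/5` to vanish, (c2*)₀ only the `E[5]`-isotypic one), so it serves the rows where
  the rank equality fails (`rank_5 Cl(ℚ(P)) > rank_5 Cl(ℚ(x(P)))`) but the extra classes live in another odd constituent.

## References

* L. C. Washington, *Introduction to Cyclotomic Fields*, GTM 83, §13.1 Prop. 13.2, §13.3 Lemmas 13.14–13.15, Thm. 10.4. [Washington1997]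
* J. Coates, R. Sujatha, *Fine Selmer groups of elliptic curves over p-adic Lie extensions*, Math. Ann. 331 (2005), §3 Thm. 3.4, Lemma 3.8. [CoatesSujatha2005]
* S. V. Deo, A. Ray, R. Sujatha, PAMQ 19 (2023), §3 Thm. 3.8. [DeoRaySujatha2023]
* J.-P. Serre, Invent. Math. 15 (1972), §2.2, §5.2 (iii). [Serre1972]
-/

set_option autoImplicit false

noncomputable section

open scoped Classical NumberField Matrix
open WeierstrassCurve Field IntermediateField
  Literature.NumberTheory.GaloisRepresentations Literature.NumberTheory.SerreUniformity
  Literature.NumberTheory.IwasawaTheory Literature.NumberTheory.NumberFields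

namespace Literature.NumberTheory.EllipticCurves.CoatesSujatha2005

namespace RankEqualityRoad

/-! ### §0 Finite facts and helpers -/

/-- Orders in `C_ns(2)` divide `24`. [folklore] -/
private theorem c2_pow₉ : ∀ a b : ZMod 5, (a, b) ≠ (0, 0) →
    ((!![a, 2 * b; b, a] : Matrix (Fin 2) (Fin 2) (ZMod 5)) ^ 8) ^ 3 = 1 := by
  decide

/-- Orders in `C_ns(3)` divide `24`. [folklore] -/
private theorem c3_pow₉ : ∀ a b : ZMod 5, (a, b) ≠ (0, 0) →
    ((!![a, 3 * b; b, a] : Matrix (Fin 2) (Fin 2) (ZMod 5)) ^ 8) ^ 3 = 1 := by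
  decide

/-- Orders in `C_ns⁺(2) ∖ C_ns(2)` divide `8`. [folklore] -/
private theorem n2_pow₉ : ∀ a b : ZMod 5, (a, b) ≠ (0, 0) →
    ((!![a, -(2 * b); b, -a] : Matrix (Fin 2) (Fin 2) (ZMod 5))) ^ 8 = 1 := by
  decide

/-- Orders in `C_ns⁺(3) ∖ C_ns(3)` divide `8`. [folklore] -/
private theorem n3_pow₉ : ∀ a b : ZMod 5, (a, b) ≠ (0, 0) →
    ((!![a, -(3 * b); b, -a] : Matrix (Fin 2) (Fin 2) (ZMod 5))) ^ 8 = 1 := by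
  decide

/-- The non-squares of `𝔽₅` are `2` and `3`. [folklore] -/
private theorem eq_two_or_three_of_not_isSquare₉ {ε : ZMod 5} (hε : ¬ IsSquare ε) : ε = 2 ∨ ε = 3 := by
  have key : ∀ e : ZMod 5, e = 0 ∨ e = 1 ∨ e = 4 ∨ e = 2 ∨ e = 3 := by decide
  rcases key ε with h | h | h | h | h
  · exact absurd ⟨0, by rw [h, mul_zero]⟩ hε
  · exact absurd ⟨1, by rw [h, mul_one]⟩ hε
  · exact absurd ⟨2, by rw [h]; decide⟩ hε
  · exact Or.inl h
  · exact Or.inr h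

/-- Every element of `C_ns⁺(ε)`, `ε ∈ {2, 3}`, has order dividing `24`. [folklore] -/
private theorem pow_24_eq_one_of_mem₉ {ε : ZMod 5} (hε : ε = 2 ∨ ε = 3) {A : Matrix (Fin 2) (Fin 2) (ZMod 5)}
    (hA : A ∈ nonsplitCartanNormalizer ε) : A ^ 24 = 1 := by
  obtain ⟨a, b, hab, rfl | rfl⟩ := hA
  · rw [show (24 : ℕ) = 8 * 3 by norm_num, pow_mul]
    rcases hε with rfl | rfl
    exacts [c2_pow₉ a b hab, c3_pow₉ a b hab]
  · rw [show (24 : ℕ) = 8 * 3 by norm_num, pow_mul]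
    rcases hε with rfl | rfl
    · rw [n2_pow₉ a b hab, one_pow]
    · rw [n3_pow₉ a b hab, one_pow]

/-- `R_ε¹² = −1` for `R_ε = (1 ε(4−ε); 4−ε 1)`, `ε ∈ {2, 3}`. [folklore] -/
private theorem R_pow_twelve₉ {ε : ZMod 5} (hε : ε = 2 ∨ ε = 3) :
    (!![1, ε * (4 - ε); 4 - ε, 1] : Matrix (Fin 2) (Fin 2) (ZMod 5)) ^ 12 = -1 := by
  rcases hε with rfl | rfl <;> decide

/-- In `𝔽₅`-coordinates, `−v = v` forces `v = 0`. [folklore] -/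
private theorem vec_eq_zero_of_neg_eq₉ (v : Fin 2 → ZMod 5) (h : -v = v) : v = 0 := by
  have key : ∀ r : ZMod 5, -r = r → r = 0 := by decide
  funext i
  exact key (v i) (by simpa using congrFun h i)

/-- Two matrices acting alike on all `e P` coincide (`e` onto). [folklore] -/
private theorem matrix_eq_of_forall_mulVec₉ {A : Type*} [AddCommGroup A] {n : ℕ} (e : A ≃+ (Fin 2 → ZMod n))
    {M N : Matrix (Fin 2) (Fin 2) (ZMod n)} (h : ∀ P : A, M *ᵥ e P = N *ᵥ e P) : M = N := by
  have h' : ∀ v, M *ᵥ v = N *ᵥ v := fun v => by simpa using h (e.symm v)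
  ext i j
  have := congrFun (h' (Pi.single j 1)) i
  simpa [Matrix.mulVec_single] using this

/-- Restriction `Γ_F → Gal(E/F)` is onto. [folklore] -/
private theorem absRestrictNormalHom_surjective₉ {F : Type} [Field F] (E : IntermediateField F (AlgebraicClosure F))
    [Normal F E] : Function.Surjective (absRestrictNormalHom E) := fun g => by
  obtain ⟨σ, hσ⟩ := AlgEquiv.restrictNormalHom_surjective (AlgebraicClosure F) g
  exact ⟨(Field.absoluteGaloisGroup.toAlgEquiv F).symm σ, hσ⟩

/-- `p ∤ #Gal(L/k)` when every element has order dividing `24` and `p ∤ 24`. [folklore] -/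
private theorem not_dvd_card_of_forall_pow_24₉ {k : Type} [Field k] (L : IntermediateField k (AlgebraicClosure k))
    [FiniteDimensional k L] {p : ℕ} (hp : p.Prime) (hp24 : ¬ p ∣ 24)
    (h24 : ∀ g : L ≃ₐ[k] L, g ^ 24 = 1) : ¬ p ∣ Nat.card (L ≃ₐ[k] L) := by
  classical
  haveI : Fact p.Prime := ⟨hp⟩
  intro h5
  rw [Nat.card_eq_fintype_card] at h5
  obtain ⟨g, hg⟩ := exists_prime_orderOf_dvd_card p h5
  have h1 : orderOf g ∣ 24 := orderOf_dvd_of_pow_eq_one (h24 g)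
  rw [hg] at h1
  exact hp24 h1

/-- `p ∤ [L : k]` from `p ∤ #Gal(L/k)`. [folklore] -/
private theorem not_dvd_finrank_of_not_dvd_card₉ {k : Type} [Field k] (L : IntermediateField k (AlgebraicClosure k))
    [FiniteDimensional k L] [IsGalois k L] {p : ℕ} (h : ¬ p ∣ Nat.card (L ≃ₐ[k] L)) : ¬ p ∣ Module.finrank k L := by
  rwa [← IsGalois.card_aut_eq_finrank k L]

/-- **(c1) `5 ∤ #Gal(ℚ(E[5])/ℚ)` for an image in `C_ns⁺(ε)`** (every element has order dividing `24`). [cite: Serre1972, §2.2] -/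
theorem not_five_dvd_card_gal_of_nonsplitCartanNormalizer (W : WeierstrassCurve ℚ) [W.IsElliptic]
    (e : W.geomTorsion (5 : ℕ) ≃+ (Fin 2 → ZMod 5)) {ε : ZMod 5} (hε : ¬ IsSquare ε)
    (he : ∀ σ : absoluteGaloisGroup ℚ, ∃ M ∈ nonsplitCartanNormalizer ε, ∀ P : W.geomTorsion (5 : ℕ), e (σ • P) = M *ᵥ e P) :
    ¬ 5 ∣ Nat.card (↥(W.divisionField 5) ≃ₐ[ℚ] ↥(W.divisionField 5)) := by
  haveI : Fact (Nat.Prime 5) := ⟨by norm_num⟩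
  have hε' := eq_two_or_three_of_not_isSquare₉ hε
  obtain ⟨ρm, hρm, hρme⟩ := exists_matrixRep_divisionField W 5 e
  have hmat : ∀ (σ : absoluteGaloisGroup ℚ) (M : Matrix (Fin 2) (Fin 2) (ZMod 5)),
      (∀ P, e (σ • P) = M *ᵥ e P) → ρm (absRestrictNormalHom _ σ) = M :=
    fun σ M hM => matrix_eq_of_forall_mulVec₉ e fun P => by rw [← hρme, hM]
  have hπ := absRestrictNormalHom_surjective₉ (W.divisionField 5)
  refine not_dvd_card_of_forall_pow_24₉ (W.divisionField 5) (p := 5) (by norm_num) (by norm_num) fun g => hρm ?_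
  obtain ⟨σ, rfl⟩ := hπ g
  obtain ⟨M, hM, hMe⟩ := he σ
  rw [map_pow, map_one, hmat σ M hMe]
  exact pow_24_eq_one_of_mem₉ hε' hM

/-! ### §1 Statement (A) at `(E, 5)` from the layer-0 isotypic input alone -/

set_option maxHeartbeats 1600000 in
set_option synthInstance.maxHeartbeats 400000 in
/-- **(A) at `(E, 5)` for a `C_ns⁺(5)`-row from (c2*)₀ alone — no named fact, no `μ`-hypothesis, no inertia or decomposition hypothesis.**  `E/ℚ`
elliptic with `Γ_ℚ` acting on `E[5]` through `C_ns⁺(ε)` in the basis `e`, `σ_x ↦ R_ε` (so `σ̄_x¹² = −1`).  If every additive `Γ_ℚ`-equivariant map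
`Cl(𝓞_{ℚ(E[5])}) → E[5]` is zero ((c2*)₀, the layer-0 `E[5]`-isotypic input), then the dual fine Selmer group of `E` over `ℚ_cyc` is finitely
generated over `ℤ_5` for every cyclotomic `ℤ_5`-extension: door L6 in inertia form (`equivariantHom_classGroup_eq_zero_layer_compositum_tower_of_inertia`,
(c3*-I) discharged by `pow_twelve_mem_inertia_of_nonsplitCartanNormalizer`: `−1 ∈ I(𝔮)` fixes no non-zero vector) + door L5
(`conjA_of_homTrivial_layer_above_p`); (c1) by `not_five_dvd_card_gal_of_nonsplitCartanNormalizer`.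
[cite: CoatesSujatha2005, §3 Thm. 3.4 and Lemma 3.8] [cite: DeoRaySujatha2023, §3 Thm. 3.8 (arXiv:2202.09937 p. 9)]
[cite: Washington1997, §13.3 Lemmas 13.14–13.15 and Thm. 10.4] [cite: Serre1972, §2.2 and §5.2 (iii)] -/
theorem conjA_five_of_nonsplitCartanBasis_of_homTrivial_layerZero (W : WeierstrassCurve ℚ) [W.IsElliptic]
    (e : W.geomTorsion (5 : ℕ) ≃+ (Fin 2 → ZMod 5)) {ε : ZMod 5} (hε : ¬ IsSquare ε)
    (he : ∀ σ : absoluteGaloisGroup ℚ, ∃ M ∈ nonsplitCartanNormalizer ε, ∀ P : W.geomTorsion (5 : ℕ), e (σ • P) = M *ᵥ e P)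
    (σx : absoluteGaloisGroup ℚ) (hσx : ∀ P : W.geomTorsion (5 : ℕ), e (σx • P) = !![1, ε * (4 - ε); 4 - ε, 1] *ᵥ e P)
    (h0 : ∀ μ : Additive (ClassGroup (𝓞 ↥(W.divisionField 5))) →+ W.geomTorsion (5 : ℕ),
      (∀ (τ : absoluteGaloisGroup ℚ) (c : ClassGroup (𝓞 ↥(W.divisionField 5))),
        μ (Additive.ofMul (ClassGroup.mulEquiv
          (AmbiguousClass.intAut (absRestrictNormalHom (W.divisionField 5) τ)) c)) = τ • μ (Additive.ofMul c)) → μ = 0)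
    (κ : ZpExtension ℚ 5) (hκ : κ.IsCyclotomic) :
    ∃ (γ : absoluteGaloisGroup ℚ) (D : W.FineSelmerDualData κ γ),
      Module.Finite ℤ_[5] (RestrictScalars ℤ_[5] (IwasawaAlgebra 5) D.X) := by
  classical
  haveI : Fact (Nat.Prime 5) := ⟨by norm_num⟩
  have hε' := eq_two_or_three_of_not_isSquare₉ hε
  have hG := not_five_dvd_card_gal_of_nonsplitCartanNormalizer W e hε he
  haveI := fun m => κ.isGalois_layer_holds m
  haveI := fun m => κ.finiteDimensional_layer_holds m
  haveI hNF : ∀ m, NumberField ↥(W.divisionField 5 ⊔ κ.layer m) := fun m => NumberField.of_module_finite ℚ _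
  haveI : NumberField ↥(W.divisionField 5) := NumberField.mk
  have hL₀ := not_dvd_finrank_of_not_dvd_card₉ (W.divisionField 5) hG
  have hram := EquivariantIwasawaLemma.exists_isMaximal_inertia_sup_kerSubgroup_eq_top_of_isCyclotomic hκ
  -- `E[5]` is `5`-torsion and fixed by `Γ_{ℚ(E[5])}`
  have hpV : ∀ v : W.geomTorsion (5 : ℕ), 5 • v = 0 := by
    intro v
    apply Subtype.ext
    have hv : ((v : W.geomTorsion (5 : ℕ)) : geomPoints W) ∈ AddSubgroup.torsionBy (geomPoints W) ((5 : ℕ) : ℤ) := v.2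
    rw [AddSubgroup.torsionBy, Submodule.mem_toAddSubgroup, Submodule.mem_torsionBy_iff] at hv
    rw [AddSubgroupClass.coe_nsmul, ZeroMemClass.coe_zero, ← natCast_zsmul]
    exact hv
  have hV : ∀ τ : absoluteGaloisGroup ℚ, absRestrictNormalHom (W.divisionField 5) τ = 1 →
      ∀ v : W.geomTorsion (5 : ℕ), τ • v = v :=
    fun τ hτ v => (W.absRestrictNormalHom_divisionField_eq_one_iff 5 τ).mp hτ v
  -- (c3*-I) is automatic: `σ_x¹²` restricts into every `I(𝔮)`, `𝔮 ∋ 5`, and acts as `−1`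
  have hDI : ∀ (𝔮 : Ideal (𝓞 ↥(W.divisionField 5))) [𝔮.IsMaximal], ((5 : ℕ) : 𝓞 ↥(W.divisionField 5)) ∈ 𝔮 →
      ∀ w : W.geomTorsion (5 : ℕ), (∀ τ : absoluteGaloisGroup ℚ,
        absRestrictNormalHom (W.divisionField 5) τ ∈ 𝔮.inertia (↥(W.divisionField 5) ≃ₐ[ℚ] ↥(W.divisionField 5)) →
          τ • w = w) → w = 0 := by
    intro 𝔮 _ h𝔮 w hw
    have hmem := pow_twelve_mem_inertia_of_nonsplitCartanNormalizer W e hε he σx hσx 𝔮 h𝔮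
    have h1 := hw (σx ^ 12) (by rw [map_pow]; exact hmem)
    have hpow : ∀ (n : ℕ) (P : W.geomTorsion (5 : ℕ)),
        e ((σx ^ n) • P) = (!![1, ε * (4 - ε); 4 - ε, 1] : Matrix (Fin 2) (Fin 2) (ZMod 5)) ^ n *ᵥ e P := by
      intro n
      induction n with
      | zero => intro P; rw [pow_zero, one_smul, pow_zero, Matrix.one_mulVec]
      | succ n ih => intro P; rw [pow_succ, mul_smul, ih, hσx, Matrix.mulVec_mulVec, ← pow_succ]
    have h2 : e w = -e w := by
      have h3 := congrArg e h1
      rw [hpow 12 w, R_pow_twelve₉ hε', Matrix.neg_mulVec, Matrix.one_mulVec] at h3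
      exact h3.symm
    have h4 : e w = 0 := vec_eq_zero_of_neg_eq₉ (e w) h2.symm
    exact e.injective (h4.trans (map_zero e).symm)
  exact conjA_of_homTrivial_layer_above_p W (by decide) hG hκ 0 (fun f hf _ =>
    EquivariantIwasawaLemma.equivariantHom_classGroup_eq_zero_layer_compositum_tower_of_inertia (by decide) κ
      (W.divisionField 5) hL₀ hram hpV hV h0 hDI (0 + 1) f hf)

end RankEqualityRoad

end Literature.NumberTheory.EllipticCurves.CoatesSujatha2005

end
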